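import Summits.Ventures.PercRepro.LemmaB

/-!
# Lemma B on sub-cubes with at most two crossing types (Daykin–Kleitman)

On a sub-cube `(S, ω₀)` write, for crossing cells `X ≠ Y`, `T_{XY}` for the set of `σ` with
`patch S σ ω₀ ∈ X` and antipode in `Y`, and `T_{⊤⊥}` / `T_{⊥⊤}` for the `(top, bot)` / `(bot, top)`
pairs. The antipode `σ ↦ flipOn S σ` is an involution exchanging `T_{XY}` and `T_{YX}`, and
`patch` turns joins/meets of `σ`'s into joins/meets of configurations while the antipode turns
them into meets/joins. Since the join of an `X`-configuration and a `Y`-configuration is in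
`top` and their meet is in `bot` (crossing cells are complementary in the partition lattice),
`T_{XY} ⊻ T_{YX} ⊆ T_{⊤⊥}` and `T_{XY} ⊼ T_{YX} ⊆ T_{⊥⊤}`; Daykin's inequality
`#s · #t ≤ #(s ⊼ t) · #(s ⊻ t)` (Mathlib `Finset.le_card_infs_mul_card_sups`) then gives
`#T_{XY} ≤ #T_{⊤⊥}`. Hence **Lemma B holds on every sub-cube on which only one unordered
crossing type occurs** (`lemmaB_subcube_of_two_types`, stated for each of the three types);
the three-type case is the open core of C-005.
-/

namespace PercRepro

open Finset
open scoped FinsetFamily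

namespace MultiGraph

variable {V E : Type*} [Fintype E] [DecidableEq E] (G : MultiGraph V E)

/-! ### `patch` and `flipOn` versus joins and meets -/

omit [Fintype E] in
/-- `patch` distributes over `⊔`. -/
theorem patch_sup (S : Finset E) (σ τ ω₀ : Config E) :
    patch S (σ ⊔ τ) ω₀ = patch S σ ω₀ ⊔ patch S τ ω₀ := by
  funext e
  simp only [patch, Pi.sup_apply]
  split_ifs <;> simp

omit [Fintype E] in
/-- `patch` distributes over `⊓`. -/
theorem patch_inf (S : Finset E) (σ τ ω₀ : Config E) :
    patch S (σ ⊓ τ) ω₀ = patch S σ ω₀ ⊓ patch S τ ω₀ := by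
  funext e
  simp only [patch, Pi.inf_apply]
  split_ifs <;> simp

omit [Fintype E] in
/-- Patching the flip of a join is the meet of the patched flips. -/
theorem patch_flipOn_sup (S : Finset E) (σ τ ω₀ : Config E) :
    patch S (flipOn S (σ ⊔ τ)) ω₀ = patch S (flipOn S σ) ω₀ ⊓ patch S (flipOn S τ) ω₀ := by
  funext e
  simp only [patch, flipOn, Pi.sup_apply, Pi.inf_apply]
  split_ifs <;> simp

omit [Fintype E] in
/-- Patching the flip of a meet is the join of the patched flips. -/
theorem patch_flipOn_inf (S : Finset E) (σ τ ω₀ : Config E) :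
    patch S (flipOn S (σ ⊓ τ)) ω₀ = patch S (flipOn S σ) ω₀ ⊔ patch S (flipOn S τ) ω₀ := by
  funext e
  simp only [patch, flipOn, Pi.sup_apply, Pi.inf_apply]
  split_ifs <;> simp

omit [Fintype E] in
/-- `flipOn S` is an involution. -/
theorem flipOn_flipOn (S : Finset E) (σ : Config E) : flipOn S (flipOn S σ) = σ := by
  funext e
  simp only [flipOn]
  split_ifs <;> simp

/-! ### Crossing cells are complementary: joins in `top`, meets in `bot` -/

omit [Fintype E] [DecidableEq E] in
/-- Disconnection in `ω` persists in `ω ⊓ ω'`. -/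
theorem not_conn_inf_left {ω ω' : Config E} {u v : V} (h : ¬ G.Conn ω u v) :
    ¬ G.Conn (ω ⊓ ω') u v := fun hc => h (Conn.mono inf_le_left hc)

omit [Fintype E] [DecidableEq E] in
/-- Disconnection in `ω'` persists in `ω ⊓ ω'`. -/
theorem not_conn_inf_right {ω ω' : Config E} {u v : V} (h : ¬ G.Conn ω' u v) :
    ¬ G.Conn (ω ⊓ ω') u v := fun hc => h (Conn.mono inf_le_right hc)

omit [Fintype E] [DecidableEq E] in
/-- Connection in `ω` persists in `ω ⊔ ω'`. -/
theorem conn_sup_left {ω ω' : Config E} {u v : V} (h : G.Conn ω u v) : G.Conn (ω ⊔ ω') u v :=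
  Conn.mono le_sup_left h

omit [Fintype E] [DecidableEq E] in
/-- Connection in `ω'` persists in `ω ⊔ ω'`. -/
theorem conn_sup_right {ω ω' : Config E} {u v : V} (h : G.Conn ω' u v) : G.Conn (ω ⊔ ω') u v :=
  Conn.mono le_sup_right h

variable {G}

omit [Fintype E] [DecidableEq E] in
/-- The join of a type-1 and a type-2 configuration lies in `topEvent`. -/
theorem sup_mem_topEvent₁₂ {a b c d : V} {ω ω' : Config E} (h : ω ∈ G.crossEvent₁ a b c d)
    (h' : ω' ∈ G.crossEvent₂ a b c d) : ω ⊔ ω' ∈ G.topEvent a b c d := by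
  rw [mem_crossEvent₁] at h
  rw [mem_crossEvent₂] at h'
  rw [mem_topEvent]
  exact ⟨G.conn_sup_left h.1, (G.conn_sup_left h.1).symm.trans (G.conn_sup_right h'.1),
    G.conn_sup_left h.2.1⟩

omit [Fintype E] [DecidableEq E] in
/-- The meet of a type-1 and a type-2 configuration lies in `botEvent`. -/
theorem inf_mem_botEvent₁₂ {a b c d : V} {ω ω' : Config E} (h : ω ∈ G.crossEvent₁ a b c d)
    (h' : ω' ∈ G.crossEvent₂ a b c d) : ω ⊓ ω' ∈ G.botEvent a b c d := by
  rw [mem_crossEvent₁] at h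
  rw [mem_crossEvent₂] at h'
  obtain ⟨hab, hcd, hac⟩ := h
  obtain ⟨hac', hbd', hab'⟩ := h'
  rw [mem_botEvent]
  refine ⟨G.not_conn_inf_right hab', G.not_conn_inf_left hac, G.not_conn_inf_left ?_,
    G.not_conn_inf_left ?_, G.not_conn_inf_left ?_, G.not_conn_inf_right ?_⟩
  · exact fun had => hac (had.trans hcd.symm)
  · exact fun hbc => hac (hab.trans hbc)
  · exact fun hbd => hac ((hab.trans hbd).trans hcd.symm)
  · exact fun hcd' => hab' ((hac'.trans hcd').trans hbd'.symm)

omit [Fintype E] [DecidableEq E] in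
/-- The join of a type-1 and a type-3 configuration lies in `topEvent`. -/
theorem sup_mem_topEvent₁₃ {a b c d : V} {ω ω' : Config E} (h : ω ∈ G.crossEvent₁ a b c d)
    (h' : ω' ∈ G.crossEvent₃ a b c d) : ω ⊔ ω' ∈ G.topEvent a b c d := by
  rw [mem_crossEvent₁] at h
  rw [mem_crossEvent₃] at h'
  rw [mem_topEvent]
  exact ⟨G.conn_sup_left h.1, G.conn_sup_right h'.2.1, G.conn_sup_left h.2.1⟩

omit [Fintype E] [DecidableEq E] in
/-- The meet of a type-1 and a type-3 configuration lies in `botEvent`. -/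
theorem inf_mem_botEvent₁₃ {a b c d : V} {ω ω' : Config E} (h : ω ∈ G.crossEvent₁ a b c d)
    (h' : ω' ∈ G.crossEvent₃ a b c d) : ω ⊓ ω' ∈ G.botEvent a b c d := by
  rw [mem_crossEvent₁] at h
  rw [mem_crossEvent₃] at h'
  obtain ⟨hab, hcd, hac⟩ := h
  obtain ⟨had', hbc', hab'⟩ := h'
  rw [mem_botEvent]
  refine ⟨G.not_conn_inf_right hab', G.not_conn_inf_left hac, G.not_conn_inf_left ?_,
    G.not_conn_inf_left ?_, G.not_conn_inf_left ?_, G.not_conn_inf_right ?_⟩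
  · exact fun had => hac (had.trans hcd.symm)
  · exact fun hbc => hac (hab.trans hbc)
  · exact fun hbd => hac ((hab.trans hbd).trans hcd.symm)
  · exact fun hcd' => hab' ((had'.trans hcd'.symm).trans hbc'.symm)

omit [Fintype E] [DecidableEq E] in
/-- The join of a type-2 and a type-3 configuration lies in `topEvent`. -/
theorem sup_mem_topEvent₂₃ {a b c d : V} {ω ω' : Config E} (h : ω ∈ G.crossEvent₂ a b c d)
    (h' : ω' ∈ G.crossEvent₃ a b c d) : ω ⊔ ω' ∈ G.topEvent a b c d := by
  rw [mem_crossEvent₂] at h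
  rw [mem_crossEvent₃] at h'
  rw [mem_topEvent]
  refine ⟨(G.conn_sup_left h.1).trans (G.conn_sup_right h'.2.1).symm, G.conn_sup_right h'.2.1,
    (G.conn_sup_left h.1).symm.trans (G.conn_sup_right h'.1)⟩

omit [Fintype E] [DecidableEq E] in
/-- The meet of a type-2 and a type-3 configuration lies in `botEvent`. -/
theorem inf_mem_botEvent₂₃ {a b c d : V} {ω ω' : Config E} (h : ω ∈ G.crossEvent₂ a b c d)
    (h' : ω' ∈ G.crossEvent₃ a b c d) : ω ⊓ ω' ∈ G.botEvent a b c d := by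
  rw [mem_crossEvent₂] at h
  rw [mem_crossEvent₃] at h'
  obtain ⟨hac, hbd, hab⟩ := h
  obtain ⟨had', hbc', hab'⟩ := h'
  rw [mem_botEvent]
  refine ⟨G.not_conn_inf_left hab, G.not_conn_inf_right ?_, G.not_conn_inf_left ?_,
    G.not_conn_inf_left ?_, G.not_conn_inf_right ?_, G.not_conn_inf_left ?_⟩
  · exact fun hac' => hab' (hac'.trans hbc'.symm)
  · exact fun had => hab (had.trans hbd.symm)
  · exact fun hbc => hab (hac.trans hbc.symm)
  · exact fun hbd' => hab' (had'.trans hbd'.symm)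
  · exact fun hcd => hab ((hac.trans hcd).trans hbd.symm)

end MultiGraph

/-! ### The antipodal pair sets of a sub-cube -/

variable {E : Type*} [Fintype E] [DecidableEq E]

open scoped Classical in
/-- The `σ` of the sub-cube `(S, ω₀)` whose configuration lies in `X` and whose antipode lies in
`Y`. -/
noncomputable def pairSet (S : Finset E) (ω₀ : Config E) (X Y : Set (Config E)) :
    Finset (Config E) :=
  univ.filter fun σ => patch S σ ω₀ ∈ X ∧ patch S (flipOn S σ) ω₀ ∈ Y

/-- Membership in `pairSet`. -/
theorem mem_pairSet {S : Finset E} {ω₀ : Config E} {X Y : Set (Config E)} {σ : Config E} :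
    σ ∈ pairSet S ω₀ X Y ↔ patch S σ ω₀ ∈ X ∧ patch S (flipOn S σ) ω₀ ∈ Y := by
  simp [pairSet]

/-- The antipode exchanges `pairSet X Y` and `pairSet Y X`: they have the same size. -/
theorem card_pairSet_comm (S : Finset E) (ω₀ : Config E) (X Y : Set (Config E)) :
    (pairSet S ω₀ X Y).card = (pairSet S ω₀ Y X).card := by
  refine Finset.card_bij (fun σ _ => flipOn S σ) ?_ ?_ ?_
  · intro σ hσ
    rw [mem_pairSet] at hσ ⊢
    rw [MultiGraph.flipOn_flipOn]
    exact ⟨hσ.2, hσ.1⟩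
  · intro σ₁ _ σ₂ _ h
    have := congrArg (flipOn S) h
    rwa [MultiGraph.flipOn_flipOn, MultiGraph.flipOn_flipOn] at this
  · intro τ hτ
    refine ⟨flipOn S τ, ?_, MultiGraph.flipOn_flipOn S τ⟩
    rw [mem_pairSet] at hτ ⊢
    rw [MultiGraph.flipOn_flipOn]
    exact ⟨hτ.2, hτ.1⟩

namespace MultiGraph

variable {V : Type*} (G : MultiGraph V E)

/-- **Daykin's inequality on a sub-cube**: if `X ⊔ Y ⊆ top` and `X ⊓ Y ⊆ bot` pointwise, then
the number of antipodal `(X, Y)` pairs is at most the number of antipodal `(top, bot)` pairs. -/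
theorem card_pairSet_le_of_complementary (S : Finset E) (ω₀ : Config E) {a b c d : V}
    {X Y : Set (Config E)}
    (hsup : ∀ ω ω', ω ∈ X → ω' ∈ Y → ω ⊔ ω' ∈ G.topEvent a b c d)
    (hinf : ∀ ω ω', ω ∈ X → ω' ∈ Y → ω ⊓ ω' ∈ G.botEvent a b c d) :
    (pairSet S ω₀ X Y).card ≤ (pairSet S ω₀ (G.topEvent a b c d) (G.botEvent a b c d)).card := by
  set s := pairSet S ω₀ X Y with hs
  set t := pairSet S ω₀ Y X with ht
  have hcard : t.card = s.card := card_pairSet_comm S ω₀ Y X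
  have hsups : s ⊻ t ⊆ pairSet S ω₀ (G.topEvent a b c d) (G.botEvent a b c d) := by
    intro ρ hρ
    rw [Finset.mem_sups] at hρ
    obtain ⟨σ, hσ, τ, hτ, rfl⟩ := hρ
    rw [hs, mem_pairSet] at hσ
    rw [ht, mem_pairSet] at hτ
    rw [mem_pairSet, patch_sup, patch_flipOn_sup, inf_comm]
    exact ⟨hsup _ _ hσ.1 hτ.1, hinf _ _ hτ.2 hσ.2⟩
  have hinfs : s ⊼ t ⊆ pairSet S ω₀ (G.botEvent a b c d) (G.topEvent a b c d) := by
    intro ρ hρ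
    rw [Finset.mem_infs] at hρ
    obtain ⟨σ, hσ, τ, hτ, rfl⟩ := hρ
    rw [hs, mem_pairSet] at hσ
    rw [ht, mem_pairSet] at hτ
    rw [mem_pairSet, patch_inf, patch_flipOn_inf, sup_comm]
    exact ⟨hinf _ _ hσ.1 hτ.1, hsup _ _ hτ.2 hσ.2⟩
  have hdk := Finset.le_card_infs_mul_card_sups s t
  have h1 := Finset.card_le_card hsups
  have h2 := Finset.card_le_card hinfs
  rw [card_pairSet_comm S ω₀ (G.botEvent a b c d)] at h2
  rw [hcard] at hdk
  have : s.card * s.card ≤ (pairSet S ω₀ (G.topEvent a b c d) (G.botEvent a b c d)).card *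
      (pairSet S ω₀ (G.topEvent a b c d) (G.botEvent a b c d)).card :=
    hdk.trans (Nat.mul_le_mul h2 h1)
  exact Nat.mul_self_le_mul_self_iff.1 this

/-- The counting form of the sub-cube sum, in terms of `pairSet`. -/
theorem antipodalSum_c005Kernel' (a b c d : V) (S : Finset E) (ω₀ : Config E) :
    ∑ σ : Config E, G.c005Kernel a b c d (patch S σ ω₀) (patch S (flipOn S σ) ω₀) =
      ((pairSet S ω₀ (G.topEvent a b c d) (G.botEvent a b c d)).card : ℝ) +
        ((pairSet S ω₀ (G.botEvent a b c d) (G.topEvent a b c d)).card : ℝ) -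
        (((pairSet S ω₀ (G.crossEvent₁ a b c d) (G.crossEvent₂ a b c d)).card : ℝ) +
          ((pairSet S ω₀ (G.crossEvent₂ a b c d) (G.crossEvent₁ a b c d)).card : ℝ) +
          ((pairSet S ω₀ (G.crossEvent₁ a b c d) (G.crossEvent₃ a b c d)).card : ℝ) +
          ((pairSet S ω₀ (G.crossEvent₃ a b c d) (G.crossEvent₁ a b c d)).card : ℝ) +
          ((pairSet S ω₀ (G.crossEvent₂ a b c d) (G.crossEvent₃ a b c d)).card : ℝ) +
          ((pairSet S ω₀ (G.crossEvent₃ a b c d) (G.crossEvent₂ a b c d)).card : ℝ)) := by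
  classical
  rw [G.antipodalSum_c005Kernel]
  simp only [pairSet]

/-- **Lemma B on a sub-cube with only the crossing type `{x₁, x₂}`**: if `x₃` never occurs in an
antipodal crossing pair, the sub-cube sum of the C-005 kernel is nonnegative. -/
theorem lemmaB_subcube_of_two_types₁₂ (a b c d : V) (S : Finset E) (ω₀ : Config E)
    (h3 : ∀ σ : Config E, patch S σ ω₀ ∈ G.crossEvent₃ a b c d →
      patch S (flipOn S σ) ω₀ ∉ G.crossEvent₁ a b c d ∧
        patch S (flipOn S σ) ω₀ ∉ G.crossEvent₂ a b c d) :
    0 ≤ ∑ σ : Config E, G.c005Kernel a b c d (patch S σ ω₀) (patch S (flipOn S σ) ω₀) := by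
  rw [G.antipodalSum_c005Kernel']
  have e13 : pairSet S ω₀ (G.crossEvent₁ a b c d) (G.crossEvent₃ a b c d) = ∅ := by
    rw [Finset.eq_empty_iff_forall_notMem]
    intro σ hσ
    rw [mem_pairSet] at hσ
    have := h3 (flipOn S σ) hσ.2
    rw [flipOn_flipOn] at this
    exact this.1 hσ.1
  have e23 : pairSet S ω₀ (G.crossEvent₂ a b c d) (G.crossEvent₃ a b c d) = ∅ := by
    rw [Finset.eq_empty_iff_forall_notMem]
    intro σ hσ
    rw [mem_pairSet] at hσ
    have := h3 (flipOn S σ) hσ.2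
    rw [flipOn_flipOn] at this
    exact this.2 hσ.1
  have e31 : pairSet S ω₀ (G.crossEvent₃ a b c d) (G.crossEvent₁ a b c d) = ∅ := by
    rw [Finset.eq_empty_iff_forall_notMem]
    intro σ hσ
    rw [mem_pairSet] at hσ
    exact (h3 σ hσ.1).1 hσ.2
  have e32 : pairSet S ω₀ (G.crossEvent₃ a b c d) (G.crossEvent₂ a b c d) = ∅ := by
    rw [Finset.eq_empty_iff_forall_notMem]
    intro σ hσ
    rw [mem_pairSet] at hσ
    exact (h3 σ hσ.1).2 hσ.2
  have hle := G.card_pairSet_le_of_complementary S ω₀ (a := a) (b := b) (c := c) (d := d)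
    (X := G.crossEvent₁ a b c d) (Y := G.crossEvent₂ a b c d)
    (fun ω ω' h h' => sup_mem_topEvent₁₂ h h') (fun ω ω' h h' => inf_mem_botEvent₁₂ h h')
  have h21 := card_pairSet_comm S ω₀ (G.crossEvent₁ a b c d) (G.crossEvent₂ a b c d)
  have hbt := card_pairSet_comm S ω₀ (G.topEvent a b c d) (G.botEvent a b c d)
  rw [e13, e23, e31, e32, Finset.card_empty, ← h21, ← hbt]
  push_cast
  have := (Nat.cast_le (α := ℝ)).2 hle
  linarith

/-- **Lemma B on a sub-cube with only the crossing type `{x₁, x₃}`** (`x₂` never occurs in an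
antipodal crossing pair). -/
theorem lemmaB_subcube_of_two_types₁₃ (a b c d : V) (S : Finset E) (ω₀ : Config E)
    (h2 : ∀ σ : Config E, patch S σ ω₀ ∈ G.crossEvent₂ a b c d →
      patch S (flipOn S σ) ω₀ ∉ G.crossEvent₁ a b c d ∧
        patch S (flipOn S σ) ω₀ ∉ G.crossEvent₃ a b c d) :
    0 ≤ ∑ σ : Config E, G.c005Kernel a b c d (patch S σ ω₀) (patch S (flipOn S σ) ω₀) := by
  rw [G.antipodalSum_c005Kernel']
  have e12 : pairSet S ω₀ (G.crossEvent₁ a b c d) (G.crossEvent₂ a b c d) = ∅ := by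
    rw [Finset.eq_empty_iff_forall_notMem]
    intro σ hσ
    rw [mem_pairSet] at hσ
    have := h2 (flipOn S σ) hσ.2
    rw [flipOn_flipOn] at this
    exact this.1 hσ.1
  have e32 : pairSet S ω₀ (G.crossEvent₃ a b c d) (G.crossEvent₂ a b c d) = ∅ := by
    rw [Finset.eq_empty_iff_forall_notMem]
    intro σ hσ
    rw [mem_pairSet] at hσ
    have := h2 (flipOn S σ) hσ.2
    rw [flipOn_flipOn] at this
    exact this.2 hσ.1
  have e21 : pairSet S ω₀ (G.crossEvent₂ a b c d) (G.crossEvent₁ a b c d) = ∅ := by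
    rw [Finset.eq_empty_iff_forall_notMem]
    intro σ hσ
    rw [mem_pairSet] at hσ
    exact (h2 σ hσ.1).1 hσ.2
  have e23 : pairSet S ω₀ (G.crossEvent₂ a b c d) (G.crossEvent₃ a b c d) = ∅ := by
    rw [Finset.eq_empty_iff_forall_notMem]
    intro σ hσ
    rw [mem_pairSet] at hσ
    exact (h2 σ hσ.1).2 hσ.2
  have hle := G.card_pairSet_le_of_complementary S ω₀ (a := a) (b := b) (c := c) (d := d)
    (X := G.crossEvent₁ a b c d) (Y := G.crossEvent₃ a b c d)
    (fun ω ω' h h' => sup_mem_topEvent₁₃ h h') (fun ω ω' h h' => inf_mem_botEvent₁₃ h h')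
  have h31 := card_pairSet_comm S ω₀ (G.crossEvent₁ a b c d) (G.crossEvent₃ a b c d)
  have hbt := card_pairSet_comm S ω₀ (G.topEvent a b c d) (G.botEvent a b c d)
  rw [e12, e32, e21, e23, Finset.card_empty, ← h31, ← hbt]
  push_cast
  have := (Nat.cast_le (α := ℝ)).2 hle
  linarith

/-- **Lemma B on a sub-cube with only the crossing type `{x₂, x₃}`** (`x₁` never occurs in an
antipodal crossing pair). -/
theorem lemmaB_subcube_of_two_types₂₃ (a b c d : V) (S : Finset E) (ω₀ : Config E)
    (h1 : ∀ σ : Config E, patch S σ ω₀ ∈ G.crossEvent₁ a b c d →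
      patch S (flipOn S σ) ω₀ ∉ G.crossEvent₂ a b c d ∧
        patch S (flipOn S σ) ω₀ ∉ G.crossEvent₃ a b c d) :
    0 ≤ ∑ σ : Config E, G.c005Kernel a b c d (patch S σ ω₀) (patch S (flipOn S σ) ω₀) := by
  rw [G.antipodalSum_c005Kernel']
  have e21 : pairSet S ω₀ (G.crossEvent₂ a b c d) (G.crossEvent₁ a b c d) = ∅ := by
    rw [Finset.eq_empty_iff_forall_notMem]
    intro σ hσ
    rw [mem_pairSet] at hσ
    have := h1 (flipOn S σ) hσ.2
    rw [flipOn_flipOn] at this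
    exact this.1 hσ.1
  have e31 : pairSet S ω₀ (G.crossEvent₃ a b c d) (G.crossEvent₁ a b c d) = ∅ := by
    rw [Finset.eq_empty_iff_forall_notMem]
    intro σ hσ
    rw [mem_pairSet] at hσ
    have := h1 (flipOn S σ) hσ.2
    rw [flipOn_flipOn] at this
    exact this.2 hσ.1
  have e12 : pairSet S ω₀ (G.crossEvent₁ a b c d) (G.crossEvent₂ a b c d) = ∅ := by
    rw [Finset.eq_empty_iff_forall_notMem]
    intro σ hσ
    rw [mem_pairSet] at hσ
    exact (h1 σ hσ.1).1 hσ.2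
  have e13 : pairSet S ω₀ (G.crossEvent₁ a b c d) (G.crossEvent₃ a b c d) = ∅ := by
    rw [Finset.eq_empty_iff_forall_notMem]
    intro σ hσ
    rw [mem_pairSet] at hσ
    exact (h1 σ hσ.1).2 hσ.2
  have hle := G.card_pairSet_le_of_complementary S ω₀ (a := a) (b := b) (c := c) (d := d)
    (X := G.crossEvent₂ a b c d) (Y := G.crossEvent₃ a b c d)
    (fun ω ω' h h' => sup_mem_topEvent₂₃ h h') (fun ω ω' h h' => inf_mem_botEvent₂₃ h h')
  have h32 := card_pairSet_comm S ω₀ (G.crossEvent₂ a b c d) (G.crossEvent₃ a b c d)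
  have hbt := card_pairSet_comm S ω₀ (G.topEvent a b c d) (G.botEvent a b c d)
  rw [e21, e31, e12, e13, Finset.card_empty, ← h32, ← hbt]
  push_cast
  have := (Nat.cast_le (α := ℝ)).2 hle
  linarith

end MultiGraph

end PercRepro
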